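import Mathlib

/-!
# Joint multi-shell certificates — abstract soundness (`FiniteRangeSplitting`, stmt-AtomisticToContinuum-12559)

Support theorem for the next rung of the `FreeSplittingCertificates` radius ladder (block-2b unit `b2b-freesplit-A`, gen 40).
VALUE = the kernel-checked combinatorial core of a matrix-valued (multi-shell) Delsarte / Lasserre-1 certificate in the style of
de Laat–de Oliveira Filho–Vallentin (arXiv:1206.2608, Thm 1.2), transplanted to radial cells around one atom — NOT summit progress.

Setting (no geometry here): finitely many points `j : ι`, each carrying a cell label `c j : Fin n`; kernels
`K k : ι → ι → ℝ` (`k : Fin (L+1)`, `K 0 ≡ 1`, unit diagonal, positive definite — in the application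
`K k j j' = P_k(cos ∠(j, j'))` by the addition theorem, or a Schur product of two such); certificate data `β₀, b, G k` with
`G k` (`k ≥ 1`) in factorised form, the bordered quadratic inequality for `(β₀, b, G 0)`, the off-diagonal sign condition, the
diagonal condition with cell weights `w` and count multipliers `lam` on cell ranges `S q` of capacity `m q`.
Conclusion: `∑ j, w (c j) ≤ β₀ + ∑ q, lam q * m q`.
-/

open Finset

namespace Summit.AtomisticToContinuum.Crystallization.Theorems.StrictSplittingRuleBirth

/-- Sum over points of a cell function = sum over cells weighted by the occupation numbers. -/
theorem sum_comp_cell {ι : Type*} [Fintype ι] {n : ℕ} (c : ι → Fin n) (f : Fin n → ℝ) :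
    ∑ j, f (c j) = ∑ i, f i * ∑ j, (if c j = i then (1 : ℝ) else 0) := by
  simp_rw [Finset.mul_sum]
  rw [Finset.sum_comm]
  refine Finset.sum_congr rfl fun j _ => ?_
  rw [Finset.sum_eq_single (c j)]
  · simp
  · intro i _ hi; simp [Ne.symm hi]
  · intro h; exact absurd (Finset.mem_univ _) h

/-- A Gram kernel is positive definite: `Z = Rᵀ R` gives `∑∑ u p u p' Z p p' = ∑ m (∑ p R m p u p)² ≥ 0`. -/
theorem gram_nonneg {κ μ : Type*} [Fintype κ] [Fintype μ] (Z : κ → κ → ℝ) (R : μ → κ → ℝ)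
    (hZ : ∀ p p', Z p p' = ∑ m, R m p * R m p') (u : κ → ℝ) :
    0 ≤ ∑ p, ∑ p', u p * u p' * Z p p' := by
  have e1 : ∀ p p', u p * u p' * Z p p' = ∑ m, (R m p * u p) * (R m p' * u p') := by
    intro p p'
    rw [hZ, Finset.mul_sum]
    exact Finset.sum_congr rfl fun m _ => by ring
  have e2 : ∑ p, ∑ p', u p * u p' * Z p p' = ∑ m, ∑ p, ∑ p', (R m p * u p) * (R m p' * u p') := by
    have i1 : ∀ p, ∑ p', ∑ m, (R m p * u p) * (R m p' * u p') = ∑ m, ∑ p', (R m p * u p) * (R m p' * u p') :=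
      fun p => Finset.sum_comm
    rw [Finset.sum_congr rfl fun p _ => Finset.sum_congr rfl fun p' _ => e1 p p',
      Finset.sum_congr rfl fun p _ => i1 p]
    exact Finset.sum_comm
  rw [e2]
  refine Finset.sum_nonneg fun m _ => ?_
  rw [← Finset.sum_mul_sum]
  exact mul_self_nonneg _

/-- Positive-definiteness of the SCHUR PRODUCT of two Gram kernels (used for a product basis `P_a · P_b`). -/
theorem schur_product_pd {ι μ μ' : Type*} [Fintype ι] [Fintype μ] [Fintype μ'] (h : μ → ι → ℝ) (h' : μ' → ι → ℝ)
    (K K' : ι → ι → ℝ) (hK : ∀ j j', K j j' = ∑ m, h m j * h m j') (hK' : ∀ j j', K' j j' = ∑ m, h' m j * h' m j')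
    (a : ι → ℝ) : 0 ≤ ∑ j, ∑ j', a j * a j' * (K j j' * K' j j') := by
  refine gram_nonneg (fun j j' => K j j' * K' j j') (fun mm : μ × μ' => fun j => h mm.1 j * h' mm.2 j) ?_ a
  intro j j'
  rw [hK, hK', Finset.sum_mul_sum, Fintype.sum_prod_type]
  exact Finset.sum_congr rfl fun m _ => Finset.sum_congr rfl fun m' _ => by ring

/-- The bordered quadratic inequality from a factorisation `[[β₀, bᵀ],[b, G₀]] = R₀ᵀ R₀`
(index `0` of `Fin (n+1)` is the border, `Fin.succ i` the cell `i`). -/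
theorem bordered_nonneg_of_factor {n : ℕ} {μ : Type*} [Fintype μ] (β₀ : ℝ) (b : Fin n → ℝ)
    (G₀ : Fin n → Fin n → ℝ) (R₀ : μ → Fin (n + 1) → ℝ)
    (h00 : β₀ = ∑ m, R₀ m 0 * R₀ m 0) (h0i : ∀ i : Fin n, b i = ∑ m, R₀ m 0 * R₀ m i.succ)
    (hij : ∀ i i' : Fin n, G₀ i i' = ∑ m, R₀ m i.succ * R₀ m i'.succ) (v : Fin n → ℝ) :
    0 ≤ β₀ + 2 * ∑ i, b i * v i + ∑ i, ∑ i', v i * v i' * G₀ i i' := by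
  -- the bordered matrix as a kernel on `Fin (n+1)`
  let row0 : Fin (n + 1) → ℝ := Fin.cons β₀ b
  let rowS : Fin n → Fin (n + 1) → ℝ := fun i => Fin.cons (b i) (G₀ i)
  let Zb : Fin (n + 1) → Fin (n + 1) → ℝ := @Fin.cons n (fun _ => Fin (n + 1) → ℝ) row0 rowS
  have hZb : ∀ p p', Zb p p' = ∑ m, R₀ m p * R₀ m p' := by
    intro p p'
    refine Fin.cases ?_ (fun i => ?_) p <;> refine Fin.cases ?_ (fun i' => ?_) p'
    · simpa [Zb, row0] using h00
    · simpa [Zb, row0] using h0i i'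
    · simp only [Zb, rowS, Fin.cons_succ, Fin.cons_zero]
      rw [h0i i]; exact Finset.sum_congr rfl fun m _ => mul_comm _ _
    · simpa [Zb, rowS] using hij i i'
  have hg := gram_nonneg Zb R₀ hZb (Fin.cons 1 v)
  simp only [Fin.sum_univ_succ, Fin.cons_zero, Fin.cons_succ, Zb, row0, rowS, one_mul, mul_one] at hg
  have e : ∑ i : Fin n, (v i * b i + ∑ i' : Fin n, v i * v i' * G₀ i i')
      = ∑ i, v i * b i + ∑ i, ∑ i', v i * v i' * G₀ i i' := Finset.sum_add_distrib
  have e2 : ∑ i : Fin n, v i * b i = ∑ i, b i * v i := Finset.sum_congr rfl fun i _ => mul_comm _ _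
  linarith [hg, e, e2]

/-- **Abstract soundness of a joint multi-shell certificate.** -/
theorem jointCert_sound {ι : Type*} [Fintype ι] [DecidableEq ι] {n L Q : ℕ} {μ : Type*} [Fintype μ]
    (c : ι → Fin n) (K : Fin (L + 1) → ι → ι → ℝ)
    (hK0 : ∀ j j', K 0 j j' = 1) (hKdiag : ∀ k j, K k j j = 1)
    (hKpd : ∀ k (a : ι → ℝ), 0 ≤ ∑ j, ∑ j', a j * a j' * K k j j')
    (β₀ : ℝ) (b : Fin n → ℝ) (G : Fin (L + 1) → Fin n → Fin n → ℝ) (R : Fin (L + 1) → μ → Fin n → ℝ)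
    (hZ : ∀ v : Fin n → ℝ, 0 ≤ β₀ + 2 * ∑ i, b i * v i + ∑ i, ∑ i', v i * v i' * G 0 i i')
    (hG : ∀ k, k ≠ 0 → ∀ i i', G k i i' = ∑ m, R k m i * R k m i')
    (hOFF : ∀ j j', j ≠ j' → ∑ k, G k (c j) (c j') * K k j j' ≤ 0)
    (S : Fin Q → Finset (Fin n)) (lam m : Fin Q → ℝ) (hlam : ∀ q, 0 ≤ lam q)
    (hcount : ∀ q, (∑ j, (if c j ∈ S q then (1 : ℝ) else 0)) ≤ m q)
    (w : Fin n → ℝ)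
    (hDIAG : ∀ i, 2 * b i + ∑ k, G k i i + w i ≤ ∑ q, (if i ∈ S q then lam q else 0)) :
    ∑ j, w (c j) ≤ β₀ + ∑ q, lam q * m q := by
  classical
  -- (1) the bordered inequality at the occupation vector, rewritten as sums over points
  have h1 : 0 ≤ β₀ + 2 * ∑ j, b (c j) + ∑ j, ∑ j', G 0 (c j) (c j') := by
    have hb : ∑ i, b i * (∑ j, if c j = i then (1 : ℝ) else 0) = ∑ j, b (c j) := (sum_comp_cell c b).symm
    have hGG : ∑ i, ∑ i', (∑ j, if c j = i then (1 : ℝ) else 0) * (∑ j, if c j = i' then (1 : ℝ) else 0) * G 0 i i'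
        = ∑ j, ∑ j', G 0 (c j) (c j') := by
      have s1 : ∀ i : Fin n, ∑ i', (∑ j, if c j = i then (1 : ℝ) else 0) * (∑ j, if c j = i' then (1 : ℝ) else 0) * G 0 i i'
          = (∑ i', G 0 i i' * ∑ j, if c j = i' then (1 : ℝ) else 0) * ∑ j, if c j = i then (1 : ℝ) else 0 := by
        intro i; rw [Finset.sum_mul]; exact Finset.sum_congr rfl fun i' _ => by ring
      rw [Finset.sum_congr rfl fun i _ => s1 i, ← sum_comp_cell c (fun i => ∑ i', G 0 i i' * ∑ j, if c j = i' then (1 : ℝ) else 0)]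
      exact Finset.sum_congr rfl fun j _ => (sum_comp_cell c (fun i' => G 0 (c j) i')).symm
    have h := hZ (fun i => ∑ j, if c j = i then (1 : ℝ) else 0)
    rw [hb, hGG] at h
    exact h
  -- (2) the factorised kernels pair nonnegatively with the PD kernels
  have h2 : ∀ k, k ≠ 0 → 0 ≤ ∑ j, ∑ j', G k (c j) (c j') * K k j j' := by
    intro k hk
    have e1 : ∀ j j', G k (c j) (c j') * K k j j' = ∑ m, R k m (c j) * R k m (c j') * K k j j' := by
      intro j j'; rw [hG k hk, Finset.sum_mul]
    have i1 : ∀ j, ∑ j', ∑ m, R k m (c j) * R k m (c j') * K k j j' = ∑ m, ∑ j', R k m (c j) * R k m (c j') * K k j j' :=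
      fun j => Finset.sum_comm
    have e : ∑ j, ∑ j', G k (c j) (c j') * K k j j' = ∑ m, ∑ j, ∑ j', R k m (c j) * R k m (c j') * K k j j' := by
      rw [Finset.sum_congr rfl fun j _ => Finset.sum_congr rfl fun j' _ => e1 j j',
        Finset.sum_congr rfl fun j _ => i1 j]
      exact Finset.sum_comm
    rw [e]
    exact Finset.sum_nonneg fun m _ => hKpd k fun j => R k m (c j)
  -- (3) total kernel pairing ≥ its k = 0 part
  have h3 : ∑ j, ∑ j', G 0 (c j) (c j') ≤ ∑ j, ∑ j', ∑ k, G k (c j) (c j') * K k j j' := by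
    have i1 : ∀ j, ∑ j', ∑ k, G k (c j) (c j') * K k j j' = ∑ k, ∑ j', G k (c j) (c j') * K k j j' :=
      fun j => Finset.sum_comm
    have e : ∑ j, ∑ j', ∑ k, G k (c j) (c j') * K k j j' = ∑ k, ∑ j, ∑ j', G k (c j) (c j') * K k j j' := by
      rw [Finset.sum_congr rfl fun j _ => i1 j]; exact Finset.sum_comm
    rw [e, ← Finset.add_sum_erase _ _ (Finset.mem_univ (0 : Fin (L + 1)))]
    simp_rw [hK0, mul_one]
    have : 0 ≤ ∑ k ∈ Finset.univ.erase (0 : Fin (L + 1)), ∑ j, ∑ j', G k (c j) (c j') * K k j j' :=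
      Finset.sum_nonneg fun k hk => h2 k (Finset.ne_of_mem_erase hk)
    linarith
  -- (4) split the pairing into diagonal and off-diagonal parts
  have h4 : ∑ j, ∑ j', ∑ k, G k (c j) (c j') * K k j j' ≤ ∑ j, ∑ k, G k (c j) (c j) := by
    refine Finset.sum_le_sum fun j _ => ?_
    rw [← Finset.add_sum_erase _ _ (Finset.mem_univ j)]
    simp_rw [hKdiag, mul_one]
    have : ∑ j' ∈ Finset.univ.erase j, ∑ k, G k (c j) (c j') * K k j j' ≤ 0 :=
      Finset.sum_nonpos fun j' hj' => hOFF j j' (Finset.ne_of_mem_erase hj').symm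
    linarith
  -- (5) diagonal condition summed over points
  have h5 : ∑ j, (2 * b (c j) + ∑ k, G k (c j) (c j) + w (c j)) ≤ ∑ j, ∑ q, (if c j ∈ S q then lam q else 0) :=
    Finset.sum_le_sum fun j _ => hDIAG (c j)
  -- (6) the multiplier side is bounded by the capacities
  have h6 : ∑ j, ∑ q, (if c j ∈ S q then lam q else 0) ≤ ∑ q, lam q * m q := by
    rw [Finset.sum_comm]
    refine Finset.sum_le_sum fun q _ => ?_
    have e : ∑ j, (if c j ∈ S q then lam q else 0) = lam q * ∑ j, (if c j ∈ S q then (1 : ℝ) else 0) := by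
      rw [Finset.mul_sum]; refine Finset.sum_congr rfl fun j _ => ?_; split_ifs <;> simp
    rw [e]
    exact mul_le_mul_of_nonneg_left (hcount q) (hlam q)
  have e5 : ∑ j, (2 * b (c j) + ∑ k, G k (c j) (c j) + w (c j))
      = 2 * ∑ j, b (c j) + ∑ j, ∑ k, G k (c j) (c j) + ∑ j, w (c j) := by
    rw [Finset.sum_add_distrib, Finset.sum_add_distrib, Finset.mul_sum]
  linarith [h1, h3, h4, h5, h6, e5]

end Summit.AtomisticToContinuum.Crystallization.Theorems.StrictSplittingRuleBirth
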